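import Summits.BirchSwinnertonDyer.BirchSwinnertonDyer.Theorems.ManinLocalTwoThreeStevensFormalSeries
import Summits.BirchSwinnertonDyer.BirchSwinnertonDyer.Theorems.ManinLocalTwoThreeStevensCurveDatum
import Summits.BirchSwinnertonDyer.BirchSwinnertonDyer.Theorems.ManinLocalTwoThreeStevensIntegralityFormalParam
import Literature.NumberTheory.EllipticCurves.RealLatticePeriod
import HarnessLib

/-!
# Steps 1–3 of the Edixhoven programme for the STEVENS lattice `Λ₁(f)`: the short-model parametrisation package of
# a globally minimal curve whose Néron lattice is `q·Λ₁(f)` (route `ManinLocalTwoThree`, cruxes C2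
# stmt-BirchSwinnertonDyer-22967 / C3 stmt-…-22968; cell bsd-f2-manin, prover p2 gen 25; CES-discharge programme,
# stage 3 step (2b))

`Γ₁(N)`-twin of Steps 1–3 of the tree's `exists_formalParam_of_neronLattice_eq_smul_periodLattice`
(`ManinConstantSemistableTwistSharpProofs`): let `W'/ℚ` be globally minimal with newform `f` and a Néron-type period
pair `L'` whose lattice is EXACTLY `q·Λ₁(f)` (`Λ₁(f) = periodLatticeGamma1 f`, `q ∈ ℚ`), and let `(F, G)` be a
RATIONAL `Γ₁(N)`-presentation of `℘_{Λ₁(f)}(ℰ_f)` (as furnished for the Stevens datum by p3's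
`StevensCurve.exists_rat_gamma1_presentation_of_gamma1Datum_one`).  Then:

* `exists_shortModelParam_of_neronLattice_eq_smul_periodLatticeGamma1` — there are `a₄, a₆ ∈ ℚ` with
  `E : y² = x³ + a₄x + a₆` elliptic (the short model of `ℂ/Λ₁(f)`; `g₂, g₃ ∈ ℚ` by p3's
  `StevensCurve.ratCast_g₂_g₃_periodLatticeGamma1`), an admissible change of variables `vc` over `ℚ` with
  `vc • E = W'`, `0 < u(vc)`, `u(vc) = ±q`, and the formal series `z` of
  `…StevensFormalSeries.exists_rat_series_formalLog_subst_eq_formalW_of_gamma1_presentation`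
  (`log_E(z) = Σ aₙ(W')qⁿ/n`, `z·Q = P`, `w_E(z)·Q₂ = P₂`);
* `exists_formalParam_of_neronLattice_eq_smul_periodLatticeGamma1` — consequently the FORMAL PARAMETER package of `W'`
  (`…StevensIntegralityFormalParam.exists_formalParam_of_shortModelParam`): `u = ±q > 0`, `t₀ ∈ qℚ⟦q⟧`,
  `[X¹]t₀ = u`, `log_{W'}(t₀) = u·Σ aₙ(W')qⁿ/n`, `t₀, w_{W'}(t₀) ∈ Frac ℤ⟦q⟧` — verbatim the conclusion of the tree's
  `exists_formalParam_of_neronLattice_eq_smul_periodLattice`, so that every abstract local core of the tree applies.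

Fact-free; standard axioms; no definitions.  BSD is not proved by this file; Manin's conjecture, C2 and C3 are not
proved by this file. [cite: EdixhovenManin1991, Prop. 2] [cite: ConradEdixhovenStein2003, §6.1, Lemma 6.1.6]
[cite: Stevens1989, §2] [cite: SilvermanAEC2009, III.1, IV.1]
-/

set_option autoImplicit false
-- lint-debt: the directory name repeats the summit name (sibling precedent `ManinLocalTwoThreeStevensCurveDatum.lean`)
set_option linter.dupNamespace false

noncomputable section

open PowerSeries
open UpperHalfPlane hiding I
open scoped MatrixGroups PeriodPair ModularForm
open CongruenceSubgroup
open WeierstrassCurve Literature.NumberTheory.EllipticCurves Literature.NumberTheory.EllipticCurves.ModularForms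
open Summit.BirchSwinnertonDyer.BirchSwinnertonDyer.Theorems.ManinLocalTwoThree.StevensCurve

namespace Summit.BirchSwinnertonDyer.BirchSwinnertonDyer.Theorems.ManinLocalTwoThree.StevensIntegrality

variable {N : ℕ} [NeZero N]

set_option maxHeartbeats 400000 in
/-- **The short-model parametrisation package for the Stevens lattice.**  For a globally minimal elliptic `W'/ℚ` with
newform `f`, a Néron-type period pair `L'` with `Λ(L') = q·Λ₁(f)` exactly, and a rational `Γ₁(N)`-presentation `(F, G)` of
`℘_{Λ₁(f)}(ℰ_f)` (w.r.t. any period pair `M` with `Λ(M) = Λ₁(f)`): rationals `a₄, a₆` with `E : y² = x³ + a₄x + a₆`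
elliptic, `vc` with `vc • E = W'`, `0 < u(vc) = ±q`, and `z ∈ qℚ⟦q⟧` with `log_E(z) = Σ aₙ(W')qⁿ/n`, `z·Q = P`,
`w_E(z)·Q₂ = P₂` (`P, Q, P₂, Q₂ ∈ ℤ⟦q⟧`, `Q, Q₂ ≠ 0`).  Steps 1–3 of the tree's
`exists_formalParam_of_neronLattice_eq_smul_periodLattice` with `Λ₀(f) ↦ Λ₁(f)`. [cite: EdixhovenManin1991, Prop. 2]
[cite: Stevens1989, §2] [cite: SilvermanAEC2009, III.1] -/
theorem exists_shortModelParam_of_neronLattice_eq_smul_periodLatticeGamma1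
    {W' : WeierstrassCurve ℚ} [W'.IsElliptic] [W'.IsGloballyMinimal] {f : CuspForm (Gamma0 N) 2}
    {L' : PeriodPair} (hf : IsNewformOf W' f) (hL' : IsNeronLatticeOf (W'.baseChange ℂ) L')
    {q : ℚ} (hq : ∀ z ∈ periodLatticeGamma1 f, (q : ℂ) * z ∈ L'.lattice)
    (hq' : ∀ z ∈ L'.lattice, ∃ w ∈ periodLatticeGamma1 f, z = q * w)
    {M : PeriodPair} (hM : ∀ x, x ∈ M.lattice ↔ x ∈ periodLatticeGamma1 f)
    {k : ℤ} (hk : 1 ≤ k) (F G : CuspForm (Gamma1 N) k) (hG : G ≠ 0)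
    (hFG : ∀ τ : ℍ, eichlerIntegral f τ ∉ M.lattice → ℘[M] (eichlerIntegral f τ) * G τ = F τ)
    (hFr : ∀ n, ∃ r : ℚ, (r : ℂ) = cuspCoeff F n) (hGr : ∀ n, ∃ r : ℚ, (r : ℂ) = cuspCoeff G n) :
    ∃ (a₄ a₆ : ℚ) (E : WeierstrassCurve ℚ) (_ : E.IsElliptic) (z : ℚ⟦X⟧) (P Q P₂ Q₂ : ℤ⟦X⟧)
      (vc : VariableChange ℚ), E = { a₁ := 0, a₂ := 0, a₃ := 0, a₄ := a₄, a₆ := a₆ } ∧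
      constantCoeff z = 0 ∧ Q ≠ 0 ∧ z * Q.map (Int.castRingHom ℚ) = P.map (Int.castRingHom ℚ) ∧ Q₂ ≠ 0 ∧
      E.formalW.subst z * Q₂.map (Int.castRingHom ℚ) = P₂.map (Int.castRingHom ℚ) ∧
      E.formalLog.subst z = (PowerSeries.mk fun n ↦ ((W'.LFunction n : ℤ) : ℚ) / n) ∧
      vc • E = W' ∧ 0 < (vc.u : ℚ) ∧ ((vc.u : ℚ) = q ∨ (vc.u : ℚ) = -q) := by
  /- Step 1: lattices. `q ≠ 0`, `L := q⁻¹ L'` spans `Λ₁(f)`, the short model `E` of `ℂ/Λ₁(f)`. -/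
  have hq0 : q ≠ 0 := by
    rintro rfl
    obtain ⟨w, -, hw⟩ := hq' L'.ω₁ L'.ω₁_mem_lattice
    rw [Rat.cast_zero, zero_mul] at hw
    exact (LinearIndependent.ne_zero 0 L'.indep) (by simpa using hw)
  have hqC : (q : ℂ) ≠ 0 := by exact_mod_cast hq0
  set L : PeriodPair := L'.mulLeft ((q : ℂ)⁻¹) (inv_ne_zero hqC) with hLdef
  have hL : ∀ x, x ∈ L.lattice ↔ x ∈ periodLatticeGamma1 f := fun x ↦ by
    rw [hLdef, PeriodPair.mem_mulLeft_lattice, inv_inv]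
    constructor
    · intro hx
      obtain ⟨w, hw, hxw⟩ := hq' _ hx
      rwa [mul_left_cancel₀ hqC hxw]
    · exact hq x
  have hΛ : L'.lattice = (L.mulLeft (q : ℂ) hqC).lattice := by
    ext z
    rw [PeriodPair.mem_mulLeft_lattice, hL]
    constructor
    · intro hz
      obtain ⟨w, hw, rfl⟩ := hq' z hz
      rwa [← mul_assoc, inv_mul_cancel₀ hqC, one_mul]
    · intro hz
      have h := hq _ hz
      rwa [← mul_assoc, mul_inv_cancel₀ hqC, one_mul] at h
  have hf0 : f ≠ 0 := hf.1.ne_zero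
  have ha : ∀ n, ((W'.LFunction n : ℤ) : ℂ) = cuspCoeff f n := fun n ↦ (hf.2 n).symm
  have hrat : ∀ n, ∃ r : ℚ, (r : ℂ) = cuspCoeff f n := fun n ↦
    ⟨(W'.LFunction n : ℚ), by rw [← ha n, Rat.cast_intCast]⟩
  obtain ⟨⟨q₂, hq₂⟩, ⟨q₃, hq₃⟩⟩ := ratCast_g₂_g₃_periodLatticeGamma1 f hf0 hrat L hL
  set a₄ : ℚ := -q₂ / 4 with ha₄
  set a₆ : ℚ := -q₃ / 4 with ha₆
  have h₂ : L.g₂ = -4 * (a₄ : ℂ) := by rw [← hq₂, ha₄]; push_cast; ring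
  have h₃ : L.g₃ = -4 * (a₆ : ℂ) := by rw [← hq₃, ha₆]; push_cast; ring
  set E : WeierstrassCurve ℚ := { a₁ := 0, a₂ := 0, a₃ := 0, a₄ := a₄, a₆ := a₆ } with hE
  haveI hEe : E.IsElliptic := isElliptic_shortModel h₂ h₃
  have hEL : IsNeronLatticeOf (E.baseChange ℂ) L := isNeronLatticeOf_shortModel h₂ h₃
  /- Step 2: the `X₁(N)`-parametrisation as a formal series `z ∈ Xℚ⟦X⟧ ∩ Frac ℤ⟦X⟧`, with `w_E(z) ∈ Frac ℤ⟦X⟧`,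
  from the rational `Γ₁(N)`-presentation transported from `M` to `L` (same lattice). -/
  have hML : M.lattice = L.lattice := by
    ext x
    rw [hM, hL]
  have hFG' : ∀ τ : ℍ, eichlerIntegral f τ ∉ L.lattice → ℘[L] (eichlerIntegral f τ) * G τ = F τ := by
    intro τ hτ
    rw [← PeriodPair.weierstrassP_eq_of_lattice_eq hML]
    exact hFG τ (by rwa [hML])
  obtain ⟨z, P, Q, P₂, Q₂, hz0, hQ, hPQ, hQ₂, hPQ₂, hlog⟩ :=
    exists_rat_series_formalLog_subst_eq_formalW_of_gamma1_presentation f hf0 (W'.LFunction : ℕ → ℤ) ha L a₄ a₆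
      h₂ h₃ hk F G hG hFG' hFr hGr
  /- Step 3: `C • E = W'` over `ℚ` with `0 < u(C)` and `u(C) = ±q`. -/
  obtain ⟨e₄, e₆⟩ := hL'.c₄_eq_of_lattice_eq_mulLeft hqC hΛ
  have hc₄E : (E.baseChange ℂ).c₄ = (E.c₄ : ℂ) := by
    simp [WeierstrassCurve.baseChange, WeierstrassCurve.map_c₄]
  have hc₆E : (E.baseChange ℂ).c₆ = (E.c₆ : ℂ) := by
    simp [WeierstrassCurve.baseChange, WeierstrassCurve.map_c₆]
  have h₄ : W'.c₄ = (q ^ 4)⁻¹ * E.c₄ := by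
    have h : ((W'.c₄ : ℚ) : ℂ) = (((q ^ 4)⁻¹ * E.c₄ : ℚ) : ℂ) := by
      rw [e₄, hEL.1, hc₄E]; push_cast; ring
    exact_mod_cast h
  have h₆ : W'.c₆ = (q ^ 6)⁻¹ * E.c₆ := by
    have h : ((W'.c₆ : ℚ) : ℂ) = (((q ^ 6)⁻¹ * E.c₆ : ℚ) : ℂ) := by
      rw [e₆, hEL.2, hc₆E]; push_cast; ring
    exact_mod_cast h
  obtain ⟨vc, hC, hCpos⟩ : ∃ vc : VariableChange ℚ, vc • E = W' ∧ 0 < (vc.u : ℚ) := by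
    obtain ⟨vc, hC⟩ := exists_variableChange_of_c₄_eq_of_c₆_eq hq0 h₄ h₆
    rcases lt_or_gt_of_ne vc.u.ne_zero with hneg | hpos
    · have hE' : (⟨-1, 0, 0, 0⟩ : VariableChange ℚ) • E = E := by
        rw [hE, smul_shortModel, inv_neg_one]
        congr 1 <;> push_cast <;> ring
      refine ⟨vc * ⟨-1, 0, 0, 0⟩, by rw [mul_smul, hE', hC], ?_⟩
      show 0 < ((vc.u * -1 : ℚˣ) : ℚ)
      rw [Units.val_mul, Units.val_neg, Units.val_one]
      linarith
    · exact ⟨vc, hC, hpos⟩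
  have hCu0 : (vc.u : ℚ) ≠ 0 := vc.u.ne_zero
  -- `u(vc) = ±q`
  have hsign : (vc.u : ℚ) = q ∨ (vc.u : ℚ) = -q := by
    have hW4 : W'.c₄ = ((vc.u : ℚ))⁻¹ ^ 4 * E.c₄ := by
      rw [← hC, variableChange_c₄, Units.val_inv_eq_inv_val]
    have hW6 : W'.c₆ = ((vc.u : ℚ))⁻¹ ^ 6 * E.c₆ := by
      rw [← hC, variableChange_c₆, Units.val_inv_eq_inv_val]
    have hΔ : E.c₄ ≠ 0 ∨ E.c₆ ≠ 0 := by
      by_contra hcon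
      rw [not_or, not_not, not_not] at hcon
      have h1728 := E.c_relation
      rw [hcon.1, hcon.2] at h1728
      exact E.isUnit_Δ.ne_zero (by linear_combination (1 / 1728 : ℚ) * h1728)
    have key : (vc.u : ℚ) ^ 4 = q ^ 4 ∨ (vc.u : ℚ) ^ 6 = q ^ 6 := by
      rcases hΔ with hc | hc
      · left
        have h' := mul_right_cancel₀ hc (hW4.symm.trans h₄)
        rw [inv_pow] at h'
        exact inv_injective h'
      · right
        have h' := mul_right_cancel₀ hc (hW6.symm.trans h₆)
        rw [inv_pow] at h'
        exact inv_injective h'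
    rcases key with h | h
    · rcases pow_eq_pow_iff_cases.mp h with h0 | h1 | ⟨h2, -⟩
      · omega
      · exact Or.inl h1
      · exact Or.inr h2
    · rcases pow_eq_pow_iff_cases.mp h with h0 | h1 | ⟨h2, -⟩
      · omega
      · exact Or.inl h1
      · exact Or.inr h2
  exact ⟨a₄, a₆, E, hEe, z, P, Q, P₂, Q₂, vc, hE, hz0, hQ, hPQ, hQ₂, hPQ₂, hlog, hC, hCpos, hsign⟩

/-- **The formal parameter package of `W'` for the Stevens lattice** — verbatim the conclusion of the tree's
`exists_formalParam_of_neronLattice_eq_smul_periodLattice`, for `Λ(L') = q·Λ₁(f)` and a rational `Γ₁(N)`-presentation: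
`u = ±q > 0`, `t₀ ∈ qℚ⟦q⟧` with `[X¹]t₀ = u`, `log_{W'}(t₀) = u·Σ aₙ(W')qⁿ/n`, and `t₀, w_{W'}(t₀) ∈ Frac ℤ⟦q⟧`.
[cite: EdixhovenManin1991, Prop. 2] [cite: ConradEdixhovenStein2003, Lemma 6.1.6] [cite: SilvermanAEC2009, IV.1] -/
theorem exists_formalParam_of_neronLattice_eq_smul_periodLatticeGamma1
    {W' : WeierstrassCurve ℚ} [W'.IsElliptic] [W'.IsGloballyMinimal] {f : CuspForm (Gamma0 N) 2}
    {L' : PeriodPair} (hf : IsNewformOf W' f) (hL' : IsNeronLatticeOf (W'.baseChange ℂ) L')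
    {q : ℚ} (hq : ∀ z ∈ periodLatticeGamma1 f, (q : ℂ) * z ∈ L'.lattice)
    (hq' : ∀ z ∈ L'.lattice, ∃ w ∈ periodLatticeGamma1 f, z = q * w)
    {M : PeriodPair} (hM : ∀ x, x ∈ M.lattice ↔ x ∈ periodLatticeGamma1 f)
    {k : ℤ} (hk : 1 ≤ k) (F G : CuspForm (Gamma1 N) k) (hG : G ≠ 0)
    (hFG : ∀ τ : ℍ, eichlerIntegral f τ ∉ M.lattice → ℘[M] (eichlerIntegral f τ) * G τ = F τ)
    (hFr : ∀ n, ∃ r : ℚ, (r : ℂ) = cuspCoeff F n) (hGr : ∀ n, ∃ r : ℚ, (r : ℂ) = cuspCoeff G n) :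
    ∃ u : ℚ, 0 < u ∧ (u = q ∨ u = -q) ∧ ∃ t₀ : ℚ⟦X⟧, constantCoeff t₀ = 0 ∧ coeff 1 t₀ = u ∧
      W'.formalLog.subst t₀ = C u * (PowerSeries.mk fun n ↦ ((W'.LFunction n : ℤ) : ℚ) / n) ∧
      ∃ P' Q' P₂' Q₂' : ℤ⟦X⟧, Q' ≠ 0 ∧ t₀ * Q'.map (Int.castRingHom ℚ) = P'.map (Int.castRingHom ℚ) ∧
        Q₂' ≠ 0 ∧
        W'.formalW.subst t₀ * Q₂'.map (Int.castRingHom ℚ) = P₂'.map (Int.castRingHom ℚ) := by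
  obtain ⟨a₄, a₆, E, hEe, z, P, Q, P₂, Q₂, vc, -, hz0, hQ, hPQ, hQ₂, hPQ₂, hlog, hC, hCpos, hsign⟩ :=
    exists_shortModelParam_of_neronLattice_eq_smul_periodLatticeGamma1 hf hL' hq hq' hM hk F G hG hFG hFr hGr
  obtain ⟨t₀, ht₀0, ht₀1, hlog₀, P', Q', P₂', Q₂', hQ', hPQ', hQ₂', hPQ₂'⟩ :=
    exists_formalParam_of_shortModelParam hz0 hQ hPQ hQ₂ hPQ₂ hlog hC
  exact ⟨(vc.u : ℚ), hCpos, hsign, t₀, ht₀0, ht₀1, hlog₀, P', Q', P₂', Q₂', hQ', hPQ', hQ₂', hPQ₂'⟩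

end Summit.BirchSwinnertonDyer.BirchSwinnertonDyer.Theorems.ManinLocalTwoThree.StevensIntegrality

end
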